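import Summits.BirchSwinnertonDyer.BirchSwinnertonDyer.Theses.AdditiveKolyvaginRoad
import Summits.BirchSwinnertonDyer.BirchSwinnertonDyer.Theorems.AdditiveKolyvaginRoadManinFrameTransport
import Summits.BirchSwinnertonDyer.Rank1Residual.X12.InertCoreEveryCurve
import Summits.BirchSwinnertonDyer.Rank1Residual.X12.CMIsogenyInvariance
import Summits.BirchSwinnertonDyer.Rank1Residual.X2.IsogenyClassStability
import Literature.NumberTheory.EllipticCurves.ComplexMultiplicationLFunctionIsogenyHoldsProofs
import HarnessLib

/-!
# Route `AdditiveKolyvaginRoad`, crux `ManinFrameResidueProper`: the decl is EQUIVALENT, on its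
# locus, to the `p`-part of Manin's conjecture for the `X₀(N)`-optimal curves of the proper residue
# (both directions, `--supports`)

Cell `pub/bsd-wall` (D-0120, W-ALL lane 3, row 2), seat `bsd-wall-akr-p2` (prover, g4). THEOREMS
ONLY (no definition, no named fact, no `sorry`); nothing is booked. This thin file imports the route
file (for the decl name) and route-independent machinery (`ManinFrameTransport` p521337/p522418,
`ManinResidueDegreeOptimal` p528365, `ManinFrameFromDatum` p512355 through the former).

WHAT THE CRUX IS. `ManinFrameResidueProper` (second resplit of `ManinGoodOddFrameAdditive`,
stmt-BirchSwinnertonDyer-20136) asks for the 9-conjunct Manin-good odd Heegner frame of an AKR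
frame `(W, p)` — `W/ℚ` globally minimal, `p ≥ 5` additive, `E[p]` irreducible, `r_an = 1` — on the
residue locus (`p < 11` or Edixhoven's exception somewhere in the class, and some member with no
`Iₙ*` fibre at `p`) under the PROPER-residue clause "every level-`N(W)` parametrisation datum of
every globally minimal member of the class has modular degree divisible by `p`" (equivalently
`p ∣ deg φ₀` at the optimal curve, `ManinResidueDegreeOptimal.forall_dvd_modularDegree_iff_dvd_optimal`).
This file certifies, in both directions and granted `PublishedInputsAdditiveKoly` (only Modularity,
conjunct 6, and Hoffstein–Luo, conjunct 7, are used), that the crux is EXACTLY the following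
print-free statement — the `p`-part of Manin's conjecture `c₀ = ±1` on the proper residue:

  (M) for every globally minimal `W₀/ℚ` with a LATTICE-OPTIMAL datum `D₀` (`Λ_{W₀} = c₀ Λ_f`, the
  strong Weil parametrisation) at level `N(W₀)`, every prime `p ≥ 5` with `Addv W₀ p`, `Irr W₀ p`,
  the residue clause for the class of `W₀`, `p ∣ deg D₀` and `r_an(W₀) = 1`: `p ∤ c₀`.

* `not_dvd_optimal_c_of_maninFrameResidueProper` — crux ⟹ (M) read on any proper-residue frame:
  the frame's sixth conjunct `p ∤ c(Dt)` for ONE member forces `p ∤ c₀` at the lattice-optimal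
  datum of any globally minimal member (`ManinFrameTransport.not_dvd_optimal_c_of_exists_not_dvd`).
* `maninFrameResidueProper_of_optimalManin` — (M) ⟹ crux: move the frame hypotheses to the
  optimal curve `W₀ ∼ W` of the class (Modularity: `X12.exists_isIsogenous_optimal`; `Addv`, `Irr`,
  `r_an` and the class-quantified residue clause are isogeny invariants; the degree clause
  instantiates at `D₀`), get `p ∤ c₀` from (M), transport the datum prime-to-`p` back to `W`
  (`ManinFrameTransport.exists_modularParametrizationData_not_dvd_of_partner`, under `Irr`) and
  build the Hoffstein–Luo frame (`ManinFrameFromDatum.exists_oddHeegnerFrame_of_exists_not_dvd`).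

So the crux is neither vacuous nor weaker than it looks: it is Manin's conjecture (`p`-part) for the
optimal curves of Kodaira type II/III/IV potentially good ordinary at `p ≥ 11`, or of semistability
defect `e ∈ {3, 4, 6}` at `p ∈ {5, 7}`, of analytic rank one with `E[p]` irreducible and `p ∣ deg φ₀`
— open in print (Edixhoven 1991 Thm. 3 needs `p > 7` off these types; Česnavičius–Neururer–Saha
2024 §1 records the exception as the state of the art; Cremona's tables give `c₀ = 1`
instance-wise only).

References: [EdixhovenManin1991] §1, Prop. 2, Thm. 3; [CesnaviciusNeururerSaha2023] Thm. 1.2, §1;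
[AgasheRibetStein2006] §2; [HoffsteinLuo1997] Theorem (§1); [Darmon2004] Thm. 3.6;
[Knapp1993] Prop. 12.9.
-/

set_option autoImplicit false
-- the Theorems directory repeats the summit name (sibling precedent `SignedBaseChangeAssembly.lean`)
set_option linter.dupNamespace false

noncomputable section

open scoped Classical

open WeierstrassCurve NumberField Literature.NumberTheory.EllipticCurves
  Literature.NumberTheory.EllipticCurves.ModularForms
  Literature.NumberTheory.EllipticCurves.Rank1Residual
  Literature.NumberTheory.DiophantineGeometry IsDedekindDomain Rat.HeightOneSpectrum
  Summit.BirchSwinnertonDyer.Rank1Residual Summit.BirchSwinnertonDyer.Rank1Residual.Additive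
  Summit.BirchSwinnertonDyer.BirchSwinnertonDyer.Theses.AdditiveKolyvaginRoad

namespace Summit.BirchSwinnertonDyer.BirchSwinnertonDyer.Theorems.ManinFrameResidueProper

/-- **The residue clause is a class invariant** (bookkeeping): both conjuncts quantify
existentially over globally minimal members `W' ∼ W`, so they transport along `W ∼ W₀` by symmetry
and transitivity of `ℚ`-isogeny. [folklore] -/
theorem residueClause_of_isIsogenous {W W₀ : WeierstrassCurve ℚ} [W.IsElliptic] [W₀.IsElliptic]
    (hiso : IsIsogenous W W₀) {p : ℕ}
    (hres : (p < 11 ∨ ∃ (W' : WeierstrassCurve ℚ) (_ : W'.IsElliptic) (_ : W'.IsGloballyMinimal),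
        IsIsogenous W W' ∧ TypeGOrd W' p ∧ padicValInt p W'.minimalDiscriminantInt ≤ 4) ∧
      (∃ (W' : WeierstrassCurve ℚ) (_ : W'.IsElliptic) (_ : W'.IsGloballyMinimal),
        IsIsogenous W W' ∧ ∀ (v : HeightOneSpectrum ℤ) (n : ℕ), natGenerator v = p →
          W'.kodairaSymbolAt v ≠ KodairaSymbol.Istar n)) :
    (p < 11 ∨ ∃ (W' : WeierstrassCurve ℚ) (_ : W'.IsElliptic) (_ : W'.IsGloballyMinimal),
        IsIsogenous W₀ W' ∧ TypeGOrd W' p ∧ padicValInt p W'.minimalDiscriminantInt ≤ 4) ∧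
      (∃ (W' : WeierstrassCurve ℚ) (_ : W'.IsElliptic) (_ : W'.IsGloballyMinimal),
        IsIsogenous W₀ W' ∧ ∀ (v : HeightOneSpectrum ℤ) (n : ℕ), natGenerator v = p →
          W'.kodairaSymbolAt v ≠ KodairaSymbol.Istar n) := by
  obtain ⟨h1, W', hE', hM', hiso', hI⟩ := hres
  refine ⟨?_, W', hE', hM', (hiso.symm_of_charZero).trans' hiso', hI⟩
  rcases h1 with h | ⟨W'', hE'', hM'', hiso'', hG, hv⟩
  · exact Or.inl h
  · exact Or.inr ⟨W'', hE'', hM'', (hiso.symm_of_charZero).trans' hiso'', hG, hv⟩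

/-- **The crux forces Manin's `p`-part at the optimal curve of every proper-residue class**: if
`ManinFrameResidueProper` holds then, granted `PublishedInputsAdditiveKoly`, for every proper-residue
frame `(W, p)` of the decl (`p ≥ 5`, `Addv`, `Irr`, residue clause, universal degree clause,
`r_an = 1`) and every LATTICE-OPTIMAL datum `D₀` (`Λ_{W₀} = c₀ Λ_f`) at level `N(W)` of every
globally minimal `W₀ ∼ W`: `p ∤ c₀` — the frame's sixth conjunct read through
`ManinFrameTransport.not_dvd_optimal_c_of_exists_not_dvd`. [cite: EdixhovenManin1991, §1 and Prop. 2]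
[cite: AgasheRibetStein2006, Thm. 2.6 and §2] -/
theorem not_dvd_optimal_c_of_maninFrameResidueProper (h : ManinFrameResidueProper)
    (hPub : PublishedInputsAdditiveKoly)
    (W : WeierstrassCurve ℚ) [W.IsElliptic] [W.IsGloballyMinimal] (p : ℕ) [hp : Fact p.Prime]
    [NeZero (W.conductorNorm ℤ)] (hp5 : 5 ≤ p) (hadd : Addv W p) (hirr : Irr W p)
    (hres : (p < 11 ∨ ∃ (W' : WeierstrassCurve ℚ) (_ : W'.IsElliptic) (_ : W'.IsGloballyMinimal),
        IsIsogenous W W' ∧ TypeGOrd W' p ∧ padicValInt p W'.minimalDiscriminantInt ≤ 4) ∧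
      (∃ (W' : WeierstrassCurve ℚ) (_ : W'.IsElliptic) (_ : W'.IsGloballyMinimal),
        IsIsogenous W W' ∧ ∀ (v : HeightOneSpectrum ℤ) (n : ℕ), natGenerator v = p →
          W'.kodairaSymbolAt v ≠ KodairaSymbol.Istar n))
    (hdeg : ∀ (W' : WeierstrassCurve ℚ) [W'.IsElliptic] [W'.IsGloballyMinimal]
      (D' : ModularParametrizationData W' (W.conductorNorm ℤ)),
      IsIsogenous W W' → p ∣ D'.modularDegree)
    (hr : W.analyticRank = 1)
    {W₀ : WeierstrassCurve ℚ} [W₀.IsElliptic] [W₀.IsGloballyMinimal] (hiso : IsIsogenous W W₀)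
    (D₀ : ModularParametrizationData W₀ (W.conductorNorm ℤ))
    (hopt : ∀ z ∈ D₀.L.lattice, ∃ w ∈ periodLattice D₀.f, z = D₀.c * w) :
    ¬ (p : ℤ) ∣ D₀.c := by
  obtain ⟨K, _, _, Dt, H, ι, P, Wd, _, _, Cd, -, -, -, -, -, hc, -⟩ :=
    h hPub W p hp5 hadd hirr hres hdeg hr
  exact ManinFrameTransport.not_dvd_optimal_c_of_exists_not_dvd W hp.out hirr ⟨Dt, hc⟩ hiso D₀ hopt

/-- **Conversely, Manin's `p`-part on the proper residue gives the crux.** Assume (M): for every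
globally minimal elliptic `W₀/ℚ`, every level `N = N(W₀)` (a free index), every LATTICE-OPTIMAL
datum `D₀` of `W₀` at level `N`, and every prime `p ≥ 5` with `Addv W₀ p`, `Irr W₀ p`, the residue
clause for the class of `W₀`, `p ∣ deg D₀` and `r_an(W₀) = 1`, one has `p ∤ c₀`. Then
`ManinFrameResidueProper` holds: given a frame `(W, p)` of the decl, Modularity
(`PublishedInputsAdditiveKoly`, conjunct 6) gives the optimal curve `W₀ ∼ W` with its lattice-optimal
datum at level `N(W) = N(W₀)` (`X12.exists_isIsogenous_optimal`); `Addv`, `Irr`, `r_an` and the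
residue clause move to `W₀` along the isogeny, the universal degree clause gives `p ∣ deg D₀`; (M)
gives `p ∤ c₀`; the prime-to-`p` transport under `Irr`
(`ManinFrameTransport.exists_modularParametrizationData_not_dvd_of_partner`) gives a datum of `W` with
`p ∤ c`, and Hoffstein–Luo (conjunct 7) with Darmon 3.6 the 9-conjunct frame
(`ManinFrameFromDatum.exists_oddHeegnerFrame_of_exists_not_dvd`). [cite: EdixhovenManin1991, Prop. 2]
[cite: HoffsteinLuo1997, Theorem (§1)] [cite: Darmon2004, Thm. 3.6] [cite: Knapp1993, Prop. 12.9] -/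
theorem maninFrameResidueProper_of_optimalManin
    (hManin : ∀ (W₀ : WeierstrassCurve ℚ) [W₀.IsElliptic] [W₀.IsGloballyMinimal] {N : ℕ} [NeZero N]
      (_ : W₀.conductorNorm ℤ = N) (D₀ : ModularParametrizationData W₀ N)
      (_ : ∀ z ∈ D₀.L.lattice, ∃ w ∈ periodLattice D₀.f, z = D₀.c * w)
      (p : ℕ) [Fact p.Prime], 5 ≤ p → Addv W₀ p → Irr W₀ p →
      ((p < 11 ∨ ∃ (W' : WeierstrassCurve ℚ) (_ : W'.IsElliptic) (_ : W'.IsGloballyMinimal),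
          IsIsogenous W₀ W' ∧ TypeGOrd W' p ∧ padicValInt p W'.minimalDiscriminantInt ≤ 4) ∧
        (∃ (W' : WeierstrassCurve ℚ) (_ : W'.IsElliptic) (_ : W'.IsGloballyMinimal),
          IsIsogenous W₀ W' ∧ ∀ (v : HeightOneSpectrum ℤ) (n : ℕ), natGenerator v = p →
            W'.kodairaSymbolAt v ≠ KodairaSymbol.Istar n)) →
      p ∣ D₀.modularDegree → W₀.analyticRank = 1 → ¬ (p : ℤ) ∣ D₀.c) :
    ManinFrameResidueProper := by
  intro hPub W _ _ p hp _ hp5 hadd hirr hres hdeg hr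
  have hnf : exists_isNewformOf := hPub.2.2.2.2.2.1
  have hHL : HoffsteinLuo1997_exists_twist_L_one_ne_zero := hPub.2.2.2.2.2.2.1
  -- the optimal curve of the class, with its lattice-optimal datum moved to level `N(W)`
  obtain ⟨W₀, hE₀, hM₀, hNz₀, D₀, hiso, hN, hopt₀⟩ := X12.exists_isIsogenous_optimal hnf W
  haveI := hE₀
  haveI := hM₀
  obtain ⟨D₀', hopt'⟩ := X12.exists_optimalDatum_of_level_eq hN D₀ hopt₀
  -- the frame hypotheses at `W₀`
  have hadd₀ : Addv W₀ p := (X2.addv_iff_of_isIsogenous (p := p) hiso).mp hadd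
  have hirr₀ : Irr W₀ p := (X12.irr_iff_of_isIsogenous hiso p).mp hirr
  have hr₀ : W₀.analyticRank = 1 := (analyticRank_eq_of_isIsogenous' hiso) ▸ hr
  have hres₀ := residueClause_of_isIsogenous hiso hres
  have hdeg₀ : p ∣ D₀'.modularDegree := hdeg W₀ D₀' hiso
  -- Manin's `p`-part at the optimal curve
  have hc₀ : ¬ (p : ℤ) ∣ D₀'.c := hManin W₀ hN D₀' hopt' p hp5 hadd₀ hirr₀ hres₀ hdeg₀ hr₀
  -- transport to `W` and frame
  exact ManinFrameFromDatum.exists_oddHeegnerFrame_of_exists_not_dvd hnf hHL W p hr (by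
      rintro rfl; omega)
    (ManinFrameTransport.exists_modularParametrizationData_not_dvd_of_partner W hp.out hirr hiso D₀'
      hc₀)

end Summit.BirchSwinnertonDyer.BirchSwinnertonDyer.Theorems.ManinFrameResidueProper

end
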